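import Literature.MathematicalPhysics.QuantumLattice.ComplexSourcePartitionFn
import HarnessLib

/-!
# The transverse Ward identity `χ⊥ = m/h` for a `U(1)`-graded Hamiltonian in a charge-`q` source,
# and `s = h²`-concavity of the sourced pressure as the sign `χ∥ ≤ χ⊥`

Topic `Literature/MathematicalPhysics/QuantumLattice` (matrix analysis behind the quantum-lattice
statements; companion of `ComplexSourcePartitionFn.lean`, `DuhamelTwoPoint(Proofs).lean`,
`ApproximatingHamiltonianProofs.lean`).

Setting (finite-dimensional, as in `ComplexSourcePartitionFn.partitionFn_sub_neg_smul_eq_of_grading`):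
a Hamiltonian `H`, a diagonal grading `N = diagonal d` commuting with `H`, and an observable `Qm`
lowering the grading by `q ≠ 0` (`[N, Qm] = -q Qm`, `[N, Qmᴴ] = +q Qmᴴ`; for a fermionic PAIR field
`q = 2`). The two Hermitian components of the source are the LONGITUDINAL `Φ₁ = Qm + Qmᴴ` and the
TRANSVERSE `Φ₂ = i(Qmᴴ - Qm)`; the grading generates the rotations `e^{cN}` of the source plane.

* `gibbsState_conj_eq`, `partitionFn_conj_eq` — covariance of `Z` and of Gibbs expectations under an
  invertible conjugation;
* `partitionFn_twoSource_eq_radial`, `gibbsState_transverse_twoSource_eq` — **radial covariance**: the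
  partition function in the source `xΦ₁ + yΦ₂` depends on `r = √(x²+y²)` only, and the transverse
  expectation rotates like a vector, `⟨Φ₂⟩_{(x,y)} = (x/r)⟨Φ₂⟩_{(r,0)} + (y/r)⟨Φ₁⟩_{(r,0)}`;
* `re_gibbsState_transverse_eq_zero` — `Re⟨Φ₂⟩_{H - hΦ₁} = 0` (`h ≠ 0`);
* **Theorem** `transverse_ward_identity` — for `h ≠ 0` and `β > 0`,
  `β · Re (Φ₂,Φ₂)_{Duh, H - hΦ₁} = Re⟨Φ₁⟩_{H - hΦ₁} / h`:
  the transverse (Duhamel/Kubo–Mori–Bogoliubov) susceptibility equals magnetisation over field — the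
  finite-volume shadow of the Goldstone theorem for the explicitly broken `U(1)`;
* `hasDerivAt_chordSusceptibility` — hence `d/dh (Re⟨Φ₁⟩_h / h) = (β/h)·[Re(Φ₁,Φ₁)_h - (Re⟨Φ₁⟩_h)² - Re(Φ₂,Φ₂)_h]`
  (`χ∥ - χ⊥` over `h`, up to `β`);
* **Theorem** `concaveOn_sq_source_of_longitudinal_le_transverse` — if `χ∥ ≤ χ⊥` along `h ∈ (a,b)`,
  `0 ≤ a`, i.e. `Re(Φ₁,Φ₁)_{H-hΦ₁} - (Re⟨Φ₁⟩_{H-hΦ₁})² ≤ Re(Φ₂,Φ₂)_{H-hΦ₁}`, then the sourced pressure is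
  CONCAVE in the squared source: `ConcaveOn ℝ [a², b²] (s ↦ log Z_β(H - √s Φ₁))`.

* `longitudinal_sub_transverse_eq_four_mul_anomalous`, `concaveOn_sq_source_of_anomalous_nonpos` — the same
  with `χ∥ - χ⊥ = 4·Re[(Qm,Qm)_Duh - ⟨Qm⟩²]` (up to `β`): the ANOMALOUS form, concavity from the sign
  `Re(Qm,Qm)_{Duh; H - hΦ₁} ≤ (Re⟨Qm⟩_{H - hΦ₁})²` of one truncated two-point function of the charged
  observable (Duhamel bilinearity `duhamel_add_left/…`, `re_duhamel_conjTranspose_conjTranspose`).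

* `longitudinal_sub_transverse_nonpos_of_concaveOn_sq_source`, `anomalous_nonpos_of_concaveOn_sq_source` — the
  CONVERSE dictionary: concavity in `s` on `[a²,b²]` forces `χ∥ ≤ χ⊥` / the anomalous sign along `h ∈ (a,b)`
  (concave differentiable ⇒ antitone derivative ⇒ antitone chord susceptibility ⇒ non-positive slope).

The concavity statements are the dictionary used by the `HubbardSuperconductivity/ThermalWedge` line
`cold-floor-collapse`: `s`-concavity of the `d`-wave-sourced torus pressure (the one physics input of
crux `TwSeededEnsembleEquivalenceR` after `Theorems.twR_of_condensation_of_fvDeepConcavity`) is the sign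
"longitudinal (amplitude/Higgs) pair susceptibility below the transverse (phase/Goldstone) one", a
statement about ONE Duhamel two-point function at non-zero source.

## References

* L. Pitaevskii, S. Stringari, *Uncertainty principle, quantum fluctuations, and broken symmetries*,
  J. Low Temp. Phys. 85 (1991) 377, §2 (transverse static susceptibility `χ⊥ = m/h` from the
  rotational Ward identity).
* T. Koma, H. Tasaki, J. Stat. Phys. 76 (1994) 745, §1 (Hamiltonian with symmetry-breaking field).
* F. J. Dyson, E. H. Lieb, B. Simon, J. Stat. Phys. 18 (1978) 335, §3 (Duhamel two-point function).
-/

noncomputable section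

open scoped Matrix.Norms.L2Operator ComplexOrder
open Matrix Finset MeasureTheory intervalIntegral Filter NormedSpace
open _root_.Topology

namespace Literature.MathematicalPhysics.QuantumLattice

variable {n : Type*} [Fintype n] [DecidableEq n]

/-! ### Covariance under an invertible conjugation -/

/-- `Z_β(W X W⁻¹) = Z_β(X)` for invertible `W` (`e^{W X W⁻¹} = W e^X W⁻¹`, cyclicity). [folklore] -/
theorem partitionFn_conj_eq (β : ℝ) {W : Matrix n n ℂ} (hW : IsUnit W) (X : Matrix n n ℂ) :
    partitionFn β (W * X * W⁻¹) = partitionFn β X := by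
  have hdet : IsUnit W.det := (Matrix.isUnit_iff_isUnit_det W).1 hW
  have hconj : W * (-(β : ℂ) • X) * W⁻¹ = -(β : ℂ) • (W * X * W⁻¹) := by
    rw [Matrix.mul_smul, Matrix.smul_mul]
  rw [partitionFn, partitionFn, gibbsWeight, gibbsWeight, ← hconj, Matrix.exp_conj _ _ hW,
    trace_mul_cycle, Matrix.nonsing_inv_mul _ hdet, Matrix.one_mul]

/-- `e^{-β W X W⁻¹} = W e^{-βX} W⁻¹` for invertible `W`. [folklore] -/
theorem gibbsWeight_conj_eq (β : ℝ) {W : Matrix n n ℂ} (hW : IsUnit W) (X : Matrix n n ℂ) :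
    gibbsWeight β (W * X * W⁻¹) = W * gibbsWeight β X * W⁻¹ := by
  have hconj : W * (-(β : ℂ) • X) * W⁻¹ = -(β : ℂ) • (W * X * W⁻¹) := by
    rw [Matrix.mul_smul, Matrix.smul_mul]
  rw [gibbsWeight, gibbsWeight, ← hconj, Matrix.exp_conj _ _ hW]

/-- **Covariance of Gibbs expectations**: `⟨W A W⁻¹⟩_{β, W X W⁻¹} = ⟨A⟩_{β, X}` for invertible `W`.
[folklore] -/
theorem gibbsState_conj_eq (β : ℝ) {W : Matrix n n ℂ} (hW : IsUnit W) (X A : Matrix n n ℂ) :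
    gibbsState β (W * X * W⁻¹) (W * A * W⁻¹) = gibbsState β X A := by
  have hdet : IsUnit W.det := (Matrix.isUnit_iff_isUnit_det W).1 hW
  rw [gibbsState_apply, gibbsState_apply, partitionFn_conj_eq β hW, gibbsWeight_conj_eq β hW]
  congr 1
  have e : W * gibbsWeight β X * W⁻¹ * (W * A * W⁻¹) = W * (gibbsWeight β X * A) * W⁻¹ := by
    calc W * gibbsWeight β X * W⁻¹ * (W * A * W⁻¹)
        = W * gibbsWeight β X * (W⁻¹ * W) * A * W⁻¹ := by simp only [Matrix.mul_assoc]
      _ = W * (gibbsWeight β X * A) * W⁻¹ := by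
          rw [Matrix.nonsing_inv_mul _ hdet, Matrix.mul_one, Matrix.mul_assoc W]
  rw [e, trace_mul_cycle, Matrix.nonsing_inv_mul _ hdet, Matrix.one_mul]

/-! ### The source plane of a graded observable: longitudinal `Φ₁ = Qm + Qmᴴ`, transverse `Φ₂ = i(Qmᴴ - Qm)` -/

omit [Fintype n] [DecidableEq n] in
/-- The two-component source in terms of the charged components:
`xΦ₁ + yΦ₂ = (x - iy) Qm + (x + iy) Qmᴴ`. [folklore] -/
theorem twoSource_eq (Qm : Matrix n n ℂ) (x y : ℂ) :
    x • (Qm + Qmᴴ) + y • (Complex.I • (Qmᴴ - Qm)) = (x - Complex.I * y) • Qm + (x + Complex.I * y) • Qmᴴ := by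
  rw [smul_smul]
  module

omit [Fintype n] [DecidableEq n] in
/-- `Φ₁ = Qm + Qmᴴ` is Hermitian. [folklore] -/
theorem isHermitian_longitudinal (Qm : Matrix n n ℂ) : (Qm + Qmᴴ).IsHermitian :=
  isHermitian_add_transpose_self _

omit [Fintype n] [DecidableEq n] in
/-- `Φ₂ = i(Qmᴴ - Qm)` is Hermitian. [folklore] -/
theorem isHermitian_transverse (Qm : Matrix n n ℂ) : (Complex.I • (Qmᴴ - Qm)).IsHermitian := by
  unfold IsHermitian
  rw [conjTranspose_smul, conjTranspose_sub, conjTranspose_conjTranspose, Complex.star_def,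
    Complex.conj_I, neg_smul, ← smul_neg, neg_sub]

section Grading

variable {H Qm : Matrix n n ℂ} {d : n → ℂ} {q : ℂ}

/-- **The grading rotates the source plane.** With `W_c = diagonal (e^{c dᵢ})`:
`W_c (H - a Qm - b Qmᴴ) W_c⁻¹ = H - (a e^{-cq}) Qm - (b e^{cq}) Qmᴴ`. [folklore] -/
theorem grading_conj_twoSource (hH : diagonal d * H - H * diagonal d = 0)
    (hQm : diagonal d * Qm - Qm * diagonal d = -q • Qm)
    (hQp : diagonal d * Qmᴴ - Qmᴴ * diagonal d = q • Qmᴴ) (c a b : ℂ) :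
    diagonal (fun i => Complex.exp (c * d i)) * (H - a • Qm - b • Qmᴴ) *
        diagonal (fun i => Complex.exp (-(c * d i))) =
      H - (a * Complex.exp (-(c * q))) • Qm - (b * Complex.exp (c * q)) • Qmᴴ := by
  have h0 := conj_eq_smul_of_grading d (q := 0) (A := H) (by simpa using hH) c
  have h1 := conj_eq_smul_of_grading d hQm c
  have h2 := conj_eq_smul_of_grading d hQp c
  rw [Matrix.mul_sub, Matrix.mul_sub, Matrix.sub_mul, Matrix.sub_mul, h0, Matrix.mul_smul,
    Matrix.smul_mul, h1, Matrix.mul_smul, Matrix.smul_mul, h2, smul_smul, smul_smul]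
  rw [mul_zero, Complex.exp_zero, one_smul, mul_neg]

/-- **The rotation aligning a two-component source with the longitudinal axis.** For real `x, y`
with `r = √(x²+y²) ≠ 0` there is an invertible `W` (a grading rotation `e^{cN}`) with
`W (H - xΦ₁ - yΦ₂) W⁻¹ = H - rΦ₁` and `W Φ₂ W⁻¹ = (x/r) Φ₂ + (y/r) Φ₁`. [folklore] -/
theorem exists_grading_rotation (hH : diagonal d * H - H * diagonal d = 0)
    (hQm : diagonal d * Qm - Qm * diagonal d = -q • Qm)
    (hQp : diagonal d * Qmᴴ - Qmᴴ * diagonal d = q • Qmᴴ) (hq : q ≠ 0) {x y : ℝ}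
    (hr : Real.sqrt (x ^ 2 + y ^ 2) ≠ 0) :
    ∃ W : Matrix n n ℂ, IsUnit W ∧
      W * (H - (x : ℂ) • (Qm + Qmᴴ) - (y : ℂ) • (Complex.I • (Qmᴴ - Qm))) * W⁻¹ =
        H - (Real.sqrt (x ^ 2 + y ^ 2) : ℂ) • (Qm + Qmᴴ) ∧
      W * (Complex.I • (Qmᴴ - Qm)) * W⁻¹ =
        ((x : ℂ) / Real.sqrt (x ^ 2 + y ^ 2)) • (Complex.I • (Qmᴴ - Qm)) +
          ((y : ℂ) / Real.sqrt (x ^ 2 + y ^ 2)) • (Qm + Qmᴴ) := by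
  set r : ℝ := Real.sqrt (x ^ 2 + y ^ 2) with hr_def
  set a : ℂ := (x : ℂ) - Complex.I * y with ha
  set b : ℂ := (x : ℂ) + Complex.I * y with hb
  have hxy : 0 ≤ x ^ 2 + y ^ 2 := by positivity
  have hab : a * b = (r : ℂ) ^ 2 := by
    have hr2 : (r : ℂ) ^ 2 = ((x ^ 2 + y ^ 2 : ℝ) : ℂ) := by
      rw [← Complex.ofReal_pow, hr_def, Real.sq_sqrt hxy]
    rw [hr2, ha, hb]
    push_cast
    ring_nf
    rw [Complex.I_sq]
    ring
  have hr0 : (r : ℂ) ≠ 0 := by exact_mod_cast hr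
  have ha0 : a ≠ 0 := by
    intro h0
    have h2 : (r : ℂ) ^ 2 = 0 := by rw [← hab, h0, zero_mul]
    exact hr0 ((pow_eq_zero_iff two_ne_zero).1 h2)
  have hb0 : b ≠ 0 := by
    intro h0
    have h2 : (r : ℂ) ^ 2 = 0 := by rw [← hab, h0, mul_zero]
    exact hr0 ((pow_eq_zero_iff two_ne_zero).1 h2)
  -- the rotation parameter: `e^{cq} = a / r`, `e^{-cq} = b / r`
  set c : ℂ := Complex.log (a / r) / q with hc
  have hcq : Complex.exp (c * q) = a / r := by
    rw [hc, div_mul_cancel₀ _ hq, Complex.exp_log (div_ne_zero ha0 hr0)]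
  have hcq' : Complex.exp (-(c * q)) = b / r := by
    rw [Complex.exp_neg, hcq, inv_div, div_eq_div_iff ha0 hr0, ← sq, ← hab]
    ring
  set W : Matrix n n ℂ := diagonal (fun i => Complex.exp (c * d i)) with hW
  set W' : Matrix n n ℂ := diagonal (fun i => Complex.exp (-(c * d i))) with hW'
  have hWW' : W * W' = 1 := diagonal_exp_mul_diagonal_exp_neg d c
  have hWu : IsUnit W :=
    (Matrix.isUnit_iff_isUnit_det W).2 (Matrix.isUnit_det_of_right_inverse hWW')
  have hWinv : W⁻¹ = W' := Matrix.inv_eq_right_inv hWW'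
  refine ⟨W, hWu, ?_, ?_⟩
  · -- the Hamiltonian: `H - xΦ₁ - yΦ₂ = H - a Qm - b Qmᴴ ↦ H - (ab/r) Qm - (ba/r) Qmᴴ = H - rΦ₁`
    have hsrc : H - (x : ℂ) • (Qm + Qmᴴ) - (y : ℂ) • (Complex.I • (Qmᴴ - Qm)) = H - a • Qm - b • Qmᴴ := by
      rw [sub_sub, sub_sub, twoSource_eq Qm (x : ℂ) (y : ℂ)]
    have e1 : a * (b / r) = r := by
      rw [mul_div_assoc', hab, sq, mul_div_assoc, div_self hr0, mul_one]
    have e2 : b * (a / r) = r := by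
      rw [mul_div_assoc', mul_comm b a, hab, sq, mul_div_assoc, div_self hr0, mul_one]
    rw [hWinv, hsrc, hW, hW', grading_conj_twoSource hH hQm hQp c a b, hcq, hcq', e1, e2, smul_add,
      sub_sub]
  · -- the transverse observable rotates like a vector
    have h1 := conj_eq_smul_of_grading d hQm c
    have h2 := conj_eq_smul_of_grading d hQp c
    rw [mul_neg] at h1
    rw [hWinv, hW, hW', Matrix.mul_smul, Matrix.smul_mul, Matrix.mul_sub, Matrix.sub_mul, h1, h2, hcq,
      hcq']
    rw [ha, hb]
    -- scalar bookkeeping in the plane spanned by `Qm`, `Qmᴴ`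
    have hI : Complex.I * Complex.I = -1 := Complex.I_mul_I
    ext i j
    simp only [Matrix.smul_apply, Matrix.sub_apply, Matrix.add_apply, smul_eq_mul]
    field_simp
    ring_nf
    rw [Complex.I_sq]
    ring

/-- **Radial covariance of the sourced partition function**: for real `x, y` with
`r = √(x² + y²) ≠ 0`, `Z_β(H - xΦ₁ - yΦ₂) = Z_β(H - rΦ₁)`. [folklore] -/
theorem partitionFn_twoSource_eq_radial (hH : diagonal d * H - H * diagonal d = 0)
    (hQm : diagonal d * Qm - Qm * diagonal d = -q • Qm)
    (hQp : diagonal d * Qmᴴ - Qmᴴ * diagonal d = q • Qmᴴ) (hq : q ≠ 0) (β : ℝ) {x y : ℝ}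
    (hr : Real.sqrt (x ^ 2 + y ^ 2) ≠ 0) :
    partitionFn β (H - (x : ℂ) • (Qm + Qmᴴ) - (y : ℂ) • (Complex.I • (Qmᴴ - Qm))) =
      partitionFn β (H - (Real.sqrt (x ^ 2 + y ^ 2) : ℂ) • (Qm + Qmᴴ)) := by
  obtain ⟨W, hWu, hWH, -⟩ := exists_grading_rotation hH hQm hQp hq hr
  rw [← partitionFn_conj_eq β hWu (H - (x : ℂ) • (Qm + Qmᴴ) - (y : ℂ) • (Complex.I • (Qmᴴ - Qm))), hWH]

/-- **The transverse expectation rotates like a vector**: for real `x, y` with `r = √(x²+y²) ≠ 0`,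
`⟨Φ₂⟩_{H - xΦ₁ - yΦ₂} = (x/r) ⟨Φ₂⟩_{H - rΦ₁} + (y/r) ⟨Φ₁⟩_{H - rΦ₁}`. [folklore] -/
theorem gibbsState_transverse_twoSource_eq (hH : diagonal d * H - H * diagonal d = 0)
    (hQm : diagonal d * Qm - Qm * diagonal d = -q • Qm)
    (hQp : diagonal d * Qmᴴ - Qmᴴ * diagonal d = q • Qmᴴ) (hq : q ≠ 0) (β : ℝ) {x y : ℝ}
    (hr : Real.sqrt (x ^ 2 + y ^ 2) ≠ 0) :
    gibbsState β (H - (x : ℂ) • (Qm + Qmᴴ) - (y : ℂ) • (Complex.I • (Qmᴴ - Qm))) (Complex.I • (Qmᴴ - Qm)) =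
      ((x : ℂ) / Real.sqrt (x ^ 2 + y ^ 2)) *
          gibbsState β (H - (Real.sqrt (x ^ 2 + y ^ 2) : ℂ) • (Qm + Qmᴴ)) (Complex.I • (Qmᴴ - Qm)) +
        ((y : ℂ) / Real.sqrt (x ^ 2 + y ^ 2)) *
          gibbsState β (H - (Real.sqrt (x ^ 2 + y ^ 2) : ℂ) • (Qm + Qmᴴ)) (Qm + Qmᴴ) := by
  obtain ⟨W, hWu, hWH, hWΦ⟩ := exists_grading_rotation hH hQm hQp hq hr
  rw [← gibbsState_conj_eq β hWu (H - (x : ℂ) • (Qm + Qmᴴ) - (y : ℂ) • (Complex.I • (Qmᴴ - Qm))), hWH, hWΦ]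
  simp only [map_add, map_smul, smul_eq_mul]

end Grading

/-! ### Calculus along the longitudinal source -/

/-- `t ↦ Re Z_β(H - tA)` is differentiable, with derivative `Re tr(βA · e^{-β(H - tA)})`. [folklore] -/
theorem hasDerivAt_re_partitionFn_sub_smul (β : ℝ) (H A : Matrix n n ℂ) (t : ℝ) :
    HasDerivAt (fun u : ℝ => (partitionFn β (H - (u : ℂ) • A)).re)
      ((((β : ℂ) • A) * NormedSpace.exp (-(β : ℂ) • H + t • ((β : ℂ) • A))).trace.re) t := by
  have h := hasDerivAt_re_trace_exp_add_smul (-(β : ℂ) • H) ((β : ℂ) • A) t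
  have hfun : (fun u : ℝ => (partitionFn β (H - (u : ℂ) • A)).re) =
      fun u : ℝ => (NormedSpace.exp (-(β : ℂ) • H + u • ((β : ℂ) • A))).trace.re := by
    funext u
    rw [partitionFn, gibbsWeight_sub_smul]
  rw [hfun]
  exact h

/-- **`d/dt log Z_β(H - tA) = β Re⟨A⟩_{H - tA}`** for Hermitian `H`, `A` and `β > 0`.
[cite: DLS1978, §3 eq. (5)] -/
theorem hasDerivAt_log_partitionFn_sub_smul {H A : Matrix n n ℂ} (hH : H.IsHermitian)
    (hA : A.IsHermitian) [Nonempty n] {β : ℝ} (hβ : 0 < β) (s : ℝ) :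
    HasDerivAt (fun t : ℝ => Real.log (partitionFn β (H - (t : ℂ) • A)).re)
      (β * (gibbsState β (H - (s : ℂ) • A) A).re) s := by
  have hβ0 : β ≠ 0 := hβ.ne'
  set 𝔄 : Matrix n n ℂ := -(β : ℂ) • H with h𝔄
  set Y : Matrix n n ℂ := (β : ℂ) • A with hY
  set Z : ℝ → ℝ := fun t => (NormedSpace.exp (𝔄 + t • Y)).trace.re with hZdef
  set N : ℝ → ℝ := fun t => (Y * NormedSpace.exp (𝔄 + t • Y)).trace.re with hNdef
  have hHt : ∀ t : ℝ, (H - (t : ℂ) • A).IsHermitian := fun t => isHermitian_sub_smul hH hA t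
  have hgW : ∀ t : ℝ, gibbsWeight β (H - (t : ℂ) • A) = NormedSpace.exp (𝔄 + t • Y) := fun t =>
    gibbsWeight_sub_smul β H A t
  have hZt : ∀ t : ℝ, Z t = (partitionFn β (H - (t : ℂ) • A)).re := by
    intro t
    simp only [hZdef, partitionFn, hgW]
  have hZpos : ∀ t, 0 < Z t := fun t => by rw [hZt]; exact partitionFn_re_pos (hHt t) β
  have hm : ∀ t : ℝ, (gibbsState β (H - (t : ℂ) • A) A).re = β⁻¹ * (N t / Z t) := by
    intro t
    have hZc : partitionFn β (H - (t : ℂ) • A) = ((Z t : ℝ) : ℂ) := by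
      rw [hZt]; exact partitionFn_eq_re (hHt t) β
    have hN : N t = β * (A * NormedSpace.exp (𝔄 + t • Y)).trace.re := by
      simp only [hNdef, hY, Matrix.smul_mul, trace_smul, smul_eq_mul, Complex.re_ofReal_mul]
    rw [gibbsState_apply, hZc, ← Complex.ofReal_inv, Complex.re_ofReal_mul, trace_mul_comm, hgW,
      hN]
    field_simp
  have hZ' : HasDerivAt Z (N s) s := hasDerivAt_re_trace_exp_add_smul 𝔄 Y s
  have hlog : HasDerivAt (fun t => Real.log (Z t)) (N s / Z s) s := hZ'.log (hZpos s).ne'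
  have hfun : (fun t : ℝ => Real.log (partitionFn β (H - (t : ℂ) • A)).re) = fun t => Real.log (Z t) :=
    funext fun t => by rw [hZt]
  rw [hfun]
  refine hlog.congr_deriv ?_
  rw [hm s]
  field_simp

/-- The radius `y ↦ √(h² + y²)` is differentiable at `y = 0` with derivative `0`, for `h ≠ 0`.
[folklore] -/
theorem hasDerivAt_sqrt_sq_add_sq {h : ℝ} (hh : h ≠ 0) :
    HasDerivAt (fun y : ℝ => Real.sqrt (h ^ 2 + y ^ 2)) 0 0 := by
  have h1 : HasDerivAt (fun y : ℝ => h ^ 2 + y ^ 2) (↑(2 : ℕ) * (0 : ℝ) ^ (2 - 1)) 0 :=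
    (hasDerivAt_pow 2 (0 : ℝ)).const_add (h ^ 2)
  have hpos : h ^ 2 + (0 : ℝ) ^ 2 ≠ 0 := by positivity
  refine ((Real.hasDerivAt_sqrt hpos).comp (0 : ℝ) h1).congr_deriv ?_
  simp

section Ward

variable {H Qm : Matrix n n ℂ} {d : n → ℂ} {q : ℂ}

/-- **The transverse expectation vanishes on the longitudinal axis**: `Re⟨Φ₂⟩_{H - hΦ₁} = 0` for
`h ≠ 0`, `β ≠ 0` (the sourced partition function is even in the transverse source by radial
covariance, so its transverse derivative `βZ Re⟨Φ₂⟩` vanishes). [folklore] -/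
theorem re_gibbsState_transverse_eq_zero (hHerm : H.IsHermitian) (hH : diagonal d * H - H * diagonal d = 0)
    (hQm : diagonal d * Qm - Qm * diagonal d = -q • Qm)
    (hQp : diagonal d * Qmᴴ - Qmᴴ * diagonal d = q • Qmᴴ) (hq : q ≠ 0) [Nonempty n] {β : ℝ} (hβ : β ≠ 0)
    {h : ℝ} (hh : h ≠ 0) :
    (gibbsState β (H - (h : ℂ) • (Qm + Qmᴴ)) (Complex.I • (Qmᴴ - Qm))).re = 0 := by
  set Φ₁ : Matrix n n ℂ := Qm + Qmᴴ with hΦ₁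
  set Φ₂ : Matrix n n ℂ := Complex.I • (Qmᴴ - Qm) with hΦ₂
  set K : Matrix n n ℂ := H - (h : ℂ) • Φ₁ with hK
  set ρ : ℝ → ℝ := fun y => Real.sqrt (h ^ 2 + y ^ 2) with hρ
  have hρne : ∀ y, ρ y ≠ 0 := fun y => by
    rw [hρ]
    exact Real.sqrt_ne_zero'.2 (by positivity)
  -- the transverse family is the longitudinal family along the radius
  set G : ℝ → ℝ := fun t => (partitionFn β (H - (t : ℂ) • Φ₁)).re with hG
  have hrad : (fun y : ℝ => (partitionFn β (K - (y : ℂ) • Φ₂)).re) = fun y => G (ρ y) := by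
    funext y
    simp only [hG, hK, hρ, hΦ₁, hΦ₂]
    rw [partitionFn_twoSource_eq_radial hH hQm hQp hq β (hρne y)]
  -- derivative `0` along the radius ...
  have hG' := hasDerivAt_re_partitionFn_sub_smul β H Φ₁ (ρ 0)
  have hcomp : HasDerivAt (fun y => G (ρ y)) 0 0 := by
    refine (hG'.comp (0 : ℝ) (hasDerivAt_sqrt_sq_add_sq hh)).congr_deriv ?_
    rw [mul_zero]
  -- ... and `Re tr(βΦ₂ e^{-βK})` along the transverse source
  have hT := hasDerivAt_re_partitionFn_sub_smul β K Φ₂ 0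
  rw [hrad] at hT
  have huniq := hT.unique hcomp
  simp only [zero_smul, add_zero] at huniq
  -- unfold the Gibbs expectation
  have hKherm : K.IsHermitian := isHermitian_sub_smul hHerm (isHermitian_longitudinal Qm) h
  have hZc : partitionFn β K = (((partitionFn β K).re : ℝ) : ℂ) := partitionFn_eq_re hKherm β
  have hZpos : 0 < (partitionFn β K).re := partitionFn_re_pos hKherm β
  rw [gibbsState_apply, hZc, ← Complex.ofReal_inv, Complex.re_ofReal_mul, trace_mul_comm, gibbsWeight]
  have e : (Φ₂ * NormedSpace.exp (-(β : ℂ) • K)).trace.re = 0 := by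
    have h2 : (((β : ℂ) • Φ₂) * NormedSpace.exp (-(β : ℂ) • K)).trace.re =
        β * (Φ₂ * NormedSpace.exp (-(β : ℂ) • K)).trace.re := by
      rw [Matrix.smul_mul, trace_smul, smul_eq_mul, Complex.re_ofReal_mul]
    rw [h2] at huniq
    exact (mul_eq_zero.1 huniq).resolve_left hβ
  rw [e, mul_zero]

/-- **The transverse Ward identity `χ⊥ = m / h`.** For a Hermitian `H` commuting with the grading,
`Qm` of charge `-q ≠ 0`, `β > 0` and a longitudinal source `h > 0`:

  `β · Re (Φ₂, Φ₂)_{Duh; H - hΦ₁} = Re⟨Φ₁⟩_{H - hΦ₁} / h`,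

`Φ₁ = Qm + Qmᴴ`, `Φ₂ = i(Qmᴴ - Qm)`: the transverse Duhamel (Kubo–Mori–Bogoliubov) susceptibility is the
longitudinal expectation over the source (rotate the source infinitesimally: `⟨Φ₂⟩_{(h,y)} =
(y/√(h²+y²)) ⟨Φ₁⟩_{(√(h²+y²),0)}` by radial covariance, and differentiate at `y = 0`).
(Cf. Pitaevskii–Stringari 1991 §2, Koma–Tasaki 1994 §1 for the rotational Ward identity behind `χ⊥ = m/h`.) [folklore] -/
theorem transverse_ward_identity (hHerm : H.IsHermitian) (hH : diagonal d * H - H * diagonal d = 0)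
    (hQm : diagonal d * Qm - Qm * diagonal d = -q • Qm)
    (hQp : diagonal d * Qmᴴ - Qmᴴ * diagonal d = q • Qmᴴ) (hq : q ≠ 0) [Nonempty n] {β : ℝ} (hβ : 0 < β)
    {h : ℝ} (hh : 0 < h) :
    β * (duhamel β (H - (h : ℂ) • (Qm + Qmᴴ)) (Complex.I • (Qmᴴ - Qm)) (Complex.I • (Qmᴴ - Qm))).re =
      (gibbsState β (H - (h : ℂ) • (Qm + Qmᴴ)) (Qm + Qmᴴ)).re / h := by
  set Φ₁ : Matrix n n ℂ := Qm + Qmᴴ with hΦ₁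
  set Φ₂ : Matrix n n ℂ := Complex.I • (Qmᴴ - Qm) with hΦ₂
  set K : Matrix n n ℂ := H - (h : ℂ) • Φ₁ with hK
  set ρ : ℝ → ℝ := fun y => Real.sqrt (h ^ 2 + y ^ 2) with hρ
  set m₁ : ℝ → ℝ := fun t => (gibbsState β (H - (t : ℂ) • Φ₁) Φ₁).re with hm₁
  set M₂ : ℝ → ℝ := fun y => (gibbsState β (K - (y : ℂ) • Φ₂) Φ₂).re with hM₂
  have hρne : ∀ y, ρ y ≠ 0 := fun y => by
    rw [hρ]
    exact Real.sqrt_ne_zero'.2 (by positivity)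
  have hρ0 : ρ 0 = h := by
    simp only [hρ]
    rw [zero_pow two_ne_zero, add_zero, Real.sqrt_sq hh.le]
  have hΦ₁herm : Φ₁.IsHermitian := isHermitian_longitudinal Qm
  have hΦ₂herm : Φ₂.IsHermitian := isHermitian_transverse Qm
  have hKherm : K.IsHermitian := isHermitian_sub_smul hHerm hΦ₁herm h
  -- (1) the transverse magnetisation along the transverse source, by radial covariance
  have hformula : M₂ = fun y => (y / ρ y) * m₁ (ρ y) := by
    funext y
    simp only [hM₂, hm₁, hK, hΦ₁, hΦ₂, hρ]
    rw [gibbsState_transverse_twoSource_eq hH hQm hQp hq β (hρne y), Complex.add_re,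
      ← Complex.ofReal_div, ← Complex.ofReal_div, Complex.re_ofReal_mul, Complex.re_ofReal_mul]
    have h0 := re_gibbsState_transverse_eq_zero hHerm hH hQm hQp hq hβ.ne' (hρne y)
    simp only [hρ] at h0
    rw [h0, mul_zero, zero_add]
  -- (2) its derivative at `y = 0` from the formula: `m₁(h)/h`
  have hm₁' := hasDerivAt_re_gibbsState_source hHerm hΦ₁herm hβ (ρ 0)
  have hv : HasDerivAt (fun y => m₁ (ρ y)) 0 0 := by
    refine (hm₁'.comp (0 : ℝ) (hasDerivAt_sqrt_sq_add_sq hh.ne')).congr_deriv ?_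
    rw [mul_zero]
  have hu : HasDerivAt (fun y : ℝ => y / ρ y) (1 / h) 0 := by
    have hd := (hasDerivAt_id (0 : ℝ)).div (hasDerivAt_sqrt_sq_add_sq hh.ne') (hρne 0)
    have e : ((1 : ℝ) * Real.sqrt (h ^ 2 + (0 : ℝ) ^ 2) - id (0 : ℝ) * 0) / Real.sqrt (h ^ 2 + (0 : ℝ) ^ 2) ^ 2 =
        1 / h := by
      have : Real.sqrt (h ^ 2 + (0 : ℝ) ^ 2) = h := by
        rw [zero_pow two_ne_zero, add_zero, Real.sqrt_sq hh.le]
      rw [this]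
      field_simp
      simp
    rw [e] at hd
    exact hd
  have hprod : HasDerivAt (fun y : ℝ => (y / ρ y) * m₁ (ρ y)) (1 / h * m₁ (ρ 0) + (0 / ρ 0) * 0) 0 :=
    hu.mul hv
  rw [zero_div, zero_mul, add_zero, hρ0] at hprod
  rw [← hformula] at hprod
  -- (3) its derivative at `y = 0` from linear response: `β Re (Φ₂,Φ₂)_K` (as `Re⟨Φ₂⟩_K = 0`)
  have hlr := hasDerivAt_re_gibbsState_source hKherm hΦ₂herm hβ 0
  have h00 : (gibbsState β (K - ((0 : ℝ) : ℂ) • Φ₂) Φ₂).re = 0 := by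
    rw [Complex.ofReal_zero, zero_smul, sub_zero]
    exact re_gibbsState_transverse_eq_zero hHerm hH hQm hQp hq hβ.ne' hh.ne'
  rw [h00, Complex.ofReal_zero, zero_smul, sub_zero] at hlr
  simp only [ne_eq, OfNat.ofNat_ne_zero, not_false_eq_true, zero_pow, sub_zero] at hlr
  -- (4) uniqueness of the derivative
  have huniq := hlr.unique hprod
  rw [huniq]
  simp only [hm₁]
  ring

end Ward

section Concavity

variable {H Qm : Matrix n n ℂ} {d : n → ℂ} {q : ℂ}

/-- **The slope of the chord susceptibility.** For `h > 0`,
`d/dh [Re⟨Φ₁⟩_{H-hΦ₁} / h] = (β/h) · [Re(Φ₁,Φ₁)_{H-hΦ₁} - (Re⟨Φ₁⟩_{H-hΦ₁})² - Re(Φ₂,Φ₂)_{H-hΦ₁}]`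
(linear response `d/dh Re⟨Φ₁⟩ = β[Re(Φ₁,Φ₁) - (Re⟨Φ₁⟩)²]` and the transverse Ward identity
`Re⟨Φ₁⟩ = hβ Re(Φ₂,Φ₂)`): the chord pair susceptibility decreases exactly where the longitudinal
susceptibility is below the transverse one. [folklore] -/
theorem hasDerivAt_chordSusceptibility (hHerm : H.IsHermitian) (hH : diagonal d * H - H * diagonal d = 0)
    (hQm : diagonal d * Qm - Qm * diagonal d = -q • Qm)
    (hQp : diagonal d * Qmᴴ - Qmᴴ * diagonal d = q • Qmᴴ) (hq : q ≠ 0) [Nonempty n] {β : ℝ} (hβ : 0 < β)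
    {h : ℝ} (hh : 0 < h) :
    HasDerivAt (fun t : ℝ => (gibbsState β (H - (t : ℂ) • (Qm + Qmᴴ)) (Qm + Qmᴴ)).re / t)
      (β / h * ((duhamel β (H - (h : ℂ) • (Qm + Qmᴴ)) (Qm + Qmᴴ) (Qm + Qmᴴ)).re -
          (gibbsState β (H - (h : ℂ) • (Qm + Qmᴴ)) (Qm + Qmᴴ)).re ^ 2 -
          (duhamel β (H - (h : ℂ) • (Qm + Qmᴴ)) (Complex.I • (Qmᴴ - Qm)) (Complex.I • (Qmᴴ - Qm))).re)) h := by
  have hm := hasDerivAt_re_gibbsState_source hHerm (isHermitian_longitudinal Qm) hβ h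
  have hd := hm.div (hasDerivAt_id h) hh.ne'
  refine hd.congr_deriv ?_
  have hW := transverse_ward_identity hHerm hH hQm hQp hq hβ hh
  set D₁ := (duhamel β (H - (h : ℂ) • (Qm + Qmᴴ)) (Qm + Qmᴴ) (Qm + Qmᴴ)).re
  set D₂ := (duhamel β (H - (h : ℂ) • (Qm + Qmᴴ)) (Complex.I • (Qmᴴ - Qm)) (Complex.I • (Qmᴴ - Qm))).re
  set m := (gibbsState β (H - (h : ℂ) • (Qm + Qmᴴ)) (Qm + Qmᴴ)).re
  have key : m = β * D₂ * h := by
    rw [eq_div_iff hh.ne'] at hW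
    linarith
  simp only [id]
  rw [div_eq_iff (pow_ne_zero 2 hh.ne'), key]
  field_simp

/-- **Concavity in the squared source from `χ∥ ≤ χ⊥`.** Let `H` be Hermitian and commute with the
grading, `Qm` of charge `-q ≠ 0`, `β > 0`, `0 ≤ a, b`. If along the longitudinal source
`h ∈ (a, b)` the longitudinal Duhamel susceptibility is at most the transverse one,

  `Re(Φ₁,Φ₁)_{H - hΦ₁} - (Re⟨Φ₁⟩_{H - hΦ₁})² ≤ Re(Φ₂,Φ₂)_{H - hΦ₁}`,

then the sourced pressure is CONCAVE in `s = h²` on `[a², b²]`: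
`ConcaveOn ℝ [a², b²] (s ↦ log Z_β(H - √s Φ₁))` (its `s`-derivative `β Re⟨Φ₁⟩_{√s}/(2√s)` is `β/2`
times the chord susceptibility, non-increasing by `hasDerivAt_chordSusceptibility`).
[folklore] -/
theorem concaveOn_sq_source_of_longitudinal_le_transverse (hHerm : H.IsHermitian)
    (hH : diagonal d * H - H * diagonal d = 0) (hQm : diagonal d * Qm - Qm * diagonal d = -q • Qm)
    (hQp : diagonal d * Qmᴴ - Qmᴴ * diagonal d = q • Qmᴴ) (hq : q ≠ 0) [Nonempty n] {β : ℝ} (hβ : 0 < β)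
    {a b : ℝ} (ha : 0 ≤ a) (hb : 0 ≤ b)
    (hsign : ∀ h ∈ Set.Ioo a b,
      (duhamel β (H - (h : ℂ) • (Qm + Qmᴴ)) (Qm + Qmᴴ) (Qm + Qmᴴ)).re -
          (gibbsState β (H - (h : ℂ) • (Qm + Qmᴴ)) (Qm + Qmᴴ)).re ^ 2 ≤
        (duhamel β (H - (h : ℂ) • (Qm + Qmᴴ)) (Complex.I • (Qmᴴ - Qm)) (Complex.I • (Qmᴴ - Qm))).re) :
    ConcaveOn ℝ (Set.Icc (a ^ 2) (b ^ 2))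
      (fun s : ℝ => Real.log (partitionFn β (H - ((Real.sqrt s : ℝ) : ℂ) • (Qm + Qmᴴ))).re) := by
  set Φ₁ : Matrix n n ℂ := Qm + Qmᴴ with hΦ₁
  have hΦ₁herm : Φ₁.IsHermitian := isHermitian_longitudinal Qm
  set F : ℝ → ℝ := fun t => Real.log (partitionFn β (H - (t : ℂ) • Φ₁)).re with hF
  set m₁ : ℝ → ℝ := fun t => (gibbsState β (H - (t : ℂ) • Φ₁) Φ₁).re with hm₁
  set φ : ℝ → ℝ := fun t => m₁ t / t with hφ
  have hF' : ∀ t, HasDerivAt F (β * m₁ t) t := fun t =>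
    hasDerivAt_log_partitionFn_sub_smul hHerm hΦ₁herm hβ t
  -- the function in the squared source and its derivative on `s > 0`
  have hf' : ∀ s : ℝ, 0 < s → HasDerivAt (fun s' : ℝ => F (Real.sqrt s')) (β / 2 * φ (Real.sqrt s)) s := by
    intro s hs
    have hc := (hF' (Real.sqrt s)).comp s (Real.hasDerivAt_sqrt hs.ne')
    refine hc.congr_deriv ?_
    have hsq : Real.sqrt s ≠ 0 := (Real.sqrt_pos.2 hs).ne'
    simp only [hφ]
    field_simp
  -- the chord susceptibility is non-increasing on `(a, b)`
  have hφ' : ∀ t ∈ Set.Ioo a b, HasDerivAt φ (β / t *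
      ((duhamel β (H - (t : ℂ) • Φ₁) Φ₁ Φ₁).re - (gibbsState β (H - (t : ℂ) • Φ₁) Φ₁).re ^ 2 -
        (duhamel β (H - (t : ℂ) • Φ₁) (Complex.I • (Qmᴴ - Qm)) (Complex.I • (Qmᴴ - Qm))).re)) t := by
    intro t ht
    exact hasDerivAt_chordSusceptibility hHerm hH hQm hQp hq hβ (lt_of_le_of_lt ha ht.1)
  have hφanti : AntitoneOn φ (Set.Ioo a b) := by
    refine antitoneOn_of_deriv_nonpos (convex_Ioo a b) ?_ ?_ ?_
    · exact fun t ht => (hφ' t ht).continuousAt.continuousWithinAt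
    · rw [interior_Ioo]
      exact fun t ht => (hφ' t ht).differentiableAt.differentiableWithinAt
    · rw [interior_Ioo]
      intro t ht
      rw [(hφ' t ht).deriv]
      have htpos : 0 < t := lt_of_le_of_lt ha ht.1
      have h1 : 0 < β / t := div_pos hβ htpos
      have h2 := hsign t ht
      nlinarith
  -- assemble
  refine AntitoneOn.concaveOn_of_deriv (convex_Icc _ _) ?_ ?_ ?_
  · have hFc : Continuous F := continuous_iff_continuousAt.2 fun t => (hF' t).continuousAt
    exact (hFc.comp Real.continuous_sqrt).continuousOn
  · rw [interior_Icc]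
    intro s hs
    have hs0 : 0 < s := lt_of_le_of_lt (sq_nonneg a) hs.1
    exact (hf' s hs0).differentiableAt.differentiableWithinAt
  · rw [interior_Icc]
    intro s₁ hs₁ s₂ hs₂ h12
    have hs₁0 : 0 < s₁ := lt_of_le_of_lt (sq_nonneg a) hs₁.1
    have hs₂0 : 0 < s₂ := lt_of_le_of_lt (sq_nonneg a) hs₂.1
    rw [(hf' s₁ hs₁0).deriv, (hf' s₂ hs₂0).deriv]
    have hmem : ∀ s ∈ Set.Ioo (a ^ 2) (b ^ 2), 0 < s → Real.sqrt s ∈ Set.Ioo a b := by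
      intro s hs hs0
      constructor
      · rw [← Real.sqrt_sq ha]
        exact Real.sqrt_lt_sqrt (sq_nonneg a) hs.1
      · rw [← Real.sqrt_sq hb]
        exact Real.sqrt_lt_sqrt hs0.le hs.2
    have hle : φ (Real.sqrt s₂) ≤ φ (Real.sqrt s₁) :=
      hφanti (hmem s₁ hs₁ hs₁0) (hmem s₂ hs₂ hs₂0) (Real.sqrt_le_sqrt h12)
    have hβ2 : 0 ≤ β / 2 := by positivity
    exact mul_le_mul_of_nonneg_left hle hβ2

end Concavity

/-! ### The anomalous form: `χ∥ - χ⊥ = 4 Re[(Qm,Qm)_Duh - ⟨Qm⟩²]` up to `β` -/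

section Anomalous

variable (β : ℝ) (H : Matrix n n ℂ)

/-- The Duhamel integrand is interval-integrable (it is continuous). [folklore] -/
theorem intervalIntegrable_trace_duhamel_integrand (A B : Matrix n n ℂ) (a b : ℝ) :
    IntervalIntegrable (fun s : ℝ =>
      (A * gibbsWeight (s * β) H * B * gibbsWeight ((1 - s) * β) H).trace) volume a b :=
  (continuous_trace_duhamel_integrand β H A B).intervalIntegrable a b

/-- Additivity of the Duhamel two-point function in the first slot. [folklore] -/
theorem duhamel_add_left (A B C : Matrix n n ℂ) :
    duhamel β H (A + B) C = duhamel β H A C + duhamel β H B C := by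
  unfold duhamel
  rw [← mul_add, ← intervalIntegral.integral_add (intervalIntegrable_trace_duhamel_integrand β H A C 0 1)
    (intervalIntegrable_trace_duhamel_integrand β H B C 0 1)]
  congr 1
  refine intervalIntegral.integral_congr fun s _ => ?_
  simp only [Matrix.add_mul, trace_add]

/-- Additivity of the Duhamel two-point function in the second slot. [folklore] -/
theorem duhamel_add_right (A B C : Matrix n n ℂ) :
    duhamel β H A (B + C) = duhamel β H A B + duhamel β H A C := by
  unfold duhamel
  rw [← mul_add, ← intervalIntegral.integral_add (intervalIntegrable_trace_duhamel_integrand β H A B 0 1)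
    (intervalIntegrable_trace_duhamel_integrand β H A C 0 1)]
  congr 1
  refine intervalIntegral.integral_congr fun s _ => ?_
  simp only [Matrix.mul_add, Matrix.add_mul, trace_add]

/-- Homogeneity of the Duhamel two-point function in the first slot. [folklore] -/
theorem duhamel_smul_left (c : ℂ) (A B : Matrix n n ℂ) :
    duhamel β H (c • A) B = c * duhamel β H A B := by
  unfold duhamel
  rw [mul_left_comm, ← smul_eq_mul c, ← intervalIntegral.integral_smul]
  congr 1
  refine intervalIntegral.integral_congr fun s _ => ?_
  simp only [Matrix.smul_mul, trace_smul]

/-- Homogeneity of the Duhamel two-point function in the second slot. [folklore] -/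
theorem duhamel_smul_right (c : ℂ) (A B : Matrix n n ℂ) :
    duhamel β H A (c • B) = c * duhamel β H A B := by
  unfold duhamel
  rw [mul_left_comm, ← smul_eq_mul c, ← intervalIntegral.integral_smul]
  congr 1
  refine intervalIntegral.integral_congr fun s _ => ?_
  simp only [Matrix.mul_smul, Matrix.smul_mul, trace_smul]

/-- The Duhamel two-point function in differences, first slot. [folklore] -/
theorem duhamel_sub_left (A B C : Matrix n n ℂ) :
    duhamel β H (A - B) C = duhamel β H A C - duhamel β H B C := by
  rw [sub_eq_add_neg, duhamel_add_left, ← neg_one_smul ℂ B, duhamel_smul_left]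
  ring

/-- The Duhamel two-point function in differences, second slot. [folklore] -/
theorem duhamel_sub_right (A B C : Matrix n n ℂ) :
    duhamel β H A (B - C) = duhamel β H A B - duhamel β H A C := by
  rw [sub_eq_add_neg, duhamel_add_right, ← neg_one_smul ℂ C, duhamel_smul_right]
  ring

variable {β H}

/-- `Re (Aᴴ, Aᴴ)_Duh = Re (A, A)_Duh` for a Hermitian Hamiltonian (the integrands are complex
conjugate: `tr(Aᴴ e^{-sβH} Aᴴ e^{-(1-s)βH}) = conj tr(A e^{-sβH} A e^{-(1-s)βH})`). [folklore] -/
theorem re_duhamel_conjTranspose_conjTranspose (hH : H.IsHermitian) (β : ℝ) (A : Matrix n n ℂ) :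
    (duhamel β H Aᴴ Aᴴ).re = (duhamel β H A A).re := by
  have hint : ∀ s : ℝ, (Aᴴ * gibbsWeight (s * β) H * Aᴴ * gibbsWeight ((1 - s) * β) H).trace =
      starRingEnd ℂ ((A * gibbsWeight (s * β) H * A * gibbsWeight ((1 - s) * β) H).trace) := by
    intro s
    have h1 : (gibbsWeight (s * β) H)ᴴ = gibbsWeight (s * β) H := (isHermitian_gibbsWeight _ hH).eq
    have h2 : (gibbsWeight ((1 - s) * β) H)ᴴ = gibbsWeight ((1 - s) * β) H :=
      (isHermitian_gibbsWeight _ hH).eq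
    rw [← Complex.star_def, ← trace_conjTranspose, conjTranspose_mul, conjTranspose_mul,
      conjTranspose_mul, h1, h2]
    -- `tr(g_{1-s} (Aᴴ (g_s Aᴴ)))` vs `tr(Aᴴ g_s Aᴴ g_{1-s})`: cyclicity
    rw [← trace_mul_comm]
    simp only [Matrix.mul_assoc]
  rw [hH.re_duhamel, hH.re_duhamel]
  congr 1
  simp_rw [hint]
  have h := (Complex.conjCLE.toContinuousLinearMap.intervalIntegral_comp_comm
    (intervalIntegrable_trace_duhamel_integrand β H A A 0 1)).symm
  simp only [ContinuousLinearEquiv.coe_coe, Complex.conjCLE_apply] at h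
  rw [← h, Complex.conj_re]

/-- `Re ⟨Aᴴ⟩ = Re ⟨A⟩` for a Hermitian Hamiltonian. [folklore] -/
theorem re_gibbsState_conjTranspose (hH : H.IsHermitian) (β : ℝ) (A : Matrix n n ℂ) :
    (gibbsState β H Aᴴ).re = (gibbsState β H A).re := by
  have hg : (gibbsWeight β H)ᴴ = gibbsWeight β H := (isHermitian_gibbsWeight _ hH).eq
  have hint : (gibbsWeight β H * Aᴴ).trace = starRingEnd ℂ ((gibbsWeight β H * A).trace) := by
    rw [← Complex.star_def, ← trace_conjTranspose, conjTranspose_mul, hg, trace_mul_comm]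
  rw [hH.re_gibbsState, hH.re_gibbsState, hint, Complex.conj_re]

/-- **`χ∥ - χ⊥` is four times the truncated ANOMALOUS correlator**: for a Hermitian `H` and any `Qm`,

  `Re(Φ₁,Φ₁)_Duh - (Re⟨Φ₁⟩)² - Re(Φ₂,Φ₂)_Duh = 4 · (Re(Qm,Qm)_Duh - (Re⟨Qm⟩)²)`,

`Φ₁ = Qm + Qmᴴ`, `Φ₂ = i(Qmᴴ - Qm)` (bilinearity; the mixed `(Qm,Qmᴴ)` terms cancel, `Re(Qmᴴ,Qmᴴ) = Re(Qm,Qm)`,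
`Re⟨Qmᴴ⟩ = Re⟨Qm⟩`). So `χ∥ ≤ χ⊥` is the sign `Re(Qm,Qm)_Duh ≤ (Re⟨Qm⟩)²` of ONE truncated two-point
function of the charged observable. [folklore] -/
theorem longitudinal_sub_transverse_eq_four_mul_anomalous (hH : H.IsHermitian) (β : ℝ) (Qm : Matrix n n ℂ) :
    (duhamel β H (Qm + Qmᴴ) (Qm + Qmᴴ)).re - (gibbsState β H (Qm + Qmᴴ)).re ^ 2 -
        (duhamel β H (Complex.I • (Qmᴴ - Qm)) (Complex.I • (Qmᴴ - Qm))).re =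
      4 * ((duhamel β H Qm Qm).re - (gibbsState β H Qm).re ^ 2) := by
  have hD := re_duhamel_conjTranspose_conjTranspose hH β Qm
  have hG := re_gibbsState_conjTranspose hH β Qm
  have e1 : duhamel β H (Qm + Qmᴴ) (Qm + Qmᴴ) =
      duhamel β H Qm Qm + duhamel β H Qm Qmᴴ + duhamel β H Qmᴴ Qm + duhamel β H Qmᴴ Qmᴴ := by
    rw [duhamel_add_left, duhamel_add_right, duhamel_add_right]
    ring
  have e2 : duhamel β H (Complex.I • (Qmᴴ - Qm)) (Complex.I • (Qmᴴ - Qm)) =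
      -(duhamel β H Qmᴴ Qmᴴ - duhamel β H Qmᴴ Qm - duhamel β H Qm Qmᴴ + duhamel β H Qm Qm) := by
    rw [duhamel_smul_left, duhamel_smul_right, duhamel_sub_left, duhamel_sub_right, duhamel_sub_right,
      ← mul_assoc, Complex.I_mul_I]
    ring
  have e3 : gibbsState β H (Qm + Qmᴴ) = gibbsState β H Qm + gibbsState β H Qmᴴ := map_add _ _ _
  rw [e1, e2, e3]
  simp only [Complex.add_re, Complex.neg_re, Complex.sub_re]
  rw [hD, hG]
  ring

end Anomalous

section AnomalousConcavity

variable {H Qm : Matrix n n ℂ} {d : n → ℂ} {q : ℂ}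

/-- **Concavity in the squared source from the anomalous sign.** As
`concaveOn_sq_source_of_longitudinal_le_transverse`, with the hypothesis in the anomalous form
`Re(Qm,Qm)_{Duh; H - hΦ₁} ≤ (Re⟨Qm⟩_{H - hΦ₁})²` for `h ∈ (a,b)` (the truncated anomalous Duhamel
correlator of the charged observable is non-positive along the longitudinal source). [folklore] -/
theorem concaveOn_sq_source_of_anomalous_nonpos (hHerm : H.IsHermitian)
    (hH : diagonal d * H - H * diagonal d = 0) (hQm : diagonal d * Qm - Qm * diagonal d = -q • Qm)
    (hQp : diagonal d * Qmᴴ - Qmᴴ * diagonal d = q • Qmᴴ) (hq : q ≠ 0) [Nonempty n] {β : ℝ} (hβ : 0 < β)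
    {a b : ℝ} (ha : 0 ≤ a) (hb : 0 ≤ b)
    (hsign : ∀ h ∈ Set.Ioo a b,
      (duhamel β (H - (h : ℂ) • (Qm + Qmᴴ)) Qm Qm).re ≤ (gibbsState β (H - (h : ℂ) • (Qm + Qmᴴ)) Qm).re ^ 2) :
    ConcaveOn ℝ (Set.Icc (a ^ 2) (b ^ 2))
      (fun s : ℝ => Real.log (partitionFn β (H - ((Real.sqrt s : ℝ) : ℂ) • (Qm + Qmᴴ))).re) := by
  refine concaveOn_sq_source_of_longitudinal_le_transverse hHerm hH hQm hQp hq hβ ha hb fun h hh => ?_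
  have hKherm : (H - (h : ℂ) • (Qm + Qmᴴ)).IsHermitian :=
    isHermitian_sub_smul hHerm (isHermitian_longitudinal Qm) h
  have e := longitudinal_sub_transverse_eq_four_mul_anomalous hKherm β Qm
  have hs := hsign h hh
  linarith

end AnomalousConcavity

/-! ### The converse dictionary: concavity in the squared source forces `χ∥ ≤ χ⊥` -/

section Converse

variable {H Qm : Matrix n n ℂ} {d : n → ℂ} {q : ℂ}

/-- **Concavity in the squared source implies `χ∥ ≤ χ⊥`.** Let `H` be Hermitian and commute with the grading,
`Qm` of charge `-q ≠ 0`, `β > 0`, `0 ≤ a`. If `s ↦ log Z_β(H - √s Φ₁)` is concave on `[a², b²]`, then along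
`h ∈ (a, b)`: `Re(Φ₁,Φ₁)_{H-hΦ₁} - (Re⟨Φ₁⟩_{H-hΦ₁})² - Re(Φ₂,Φ₂)_{H-hΦ₁} ≤ 0` (the derivative `(β/2)·Re⟨Φ₁⟩_{√s}/√s` of a
concave differentiable function is antitone, so the chord susceptibility is antitone on `(a,b)` and its derivative
`(β/h)·[…]` (`hasDerivAt_chordSusceptibility`) is non-positive). Converse of
`concaveOn_sq_source_of_longitudinal_le_transverse`. [folklore] -/
theorem longitudinal_sub_transverse_nonpos_of_concaveOn_sq_source (hHerm : H.IsHermitian)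
    (hH : diagonal d * H - H * diagonal d = 0) (hQm : diagonal d * Qm - Qm * diagonal d = -q • Qm)
    (hQp : diagonal d * Qmᴴ - Qmᴴ * diagonal d = q • Qmᴴ) (hq : q ≠ 0) [Nonempty n] {β : ℝ} (hβ : 0 < β)
    {a b : ℝ} (ha : 0 ≤ a)
    (hconc : ConcaveOn ℝ (Set.Icc (a ^ 2) (b ^ 2))
      (fun s : ℝ => Real.log (partitionFn β (H - ((Real.sqrt s : ℝ) : ℂ) • (Qm + Qmᴴ))).re)) :
    ∀ h ∈ Set.Ioo a b,
      (duhamel β (H - (h : ℂ) • (Qm + Qmᴴ)) (Qm + Qmᴴ) (Qm + Qmᴴ)).re -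
          (gibbsState β (H - (h : ℂ) • (Qm + Qmᴴ)) (Qm + Qmᴴ)).re ^ 2 -
        (duhamel β (H - (h : ℂ) • (Qm + Qmᴴ)) (Complex.I • (Qmᴴ - Qm)) (Complex.I • (Qmᴴ - Qm))).re ≤ 0 := by
  intro h hh
  set Φ₁ : Matrix n n ℂ := Qm + Qmᴴ with hΦ₁
  have hΦ₁herm : Φ₁.IsHermitian := isHermitian_longitudinal Qm
  set F : ℝ → ℝ := fun t => Real.log (partitionFn β (H - (t : ℂ) • Φ₁)).re with hF
  set m₁ : ℝ → ℝ := fun t => (gibbsState β (H - (t : ℂ) • Φ₁) Φ₁).re with hm₁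
  set φ : ℝ → ℝ := fun t => m₁ t / t with hφ
  set P : ℝ → ℝ := fun s => F (Real.sqrt s) with hP
  have hF' : ∀ t, HasDerivAt F (β * m₁ t) t := fun t =>
    hasDerivAt_log_partitionFn_sub_smul hHerm hΦ₁herm hβ t
  have hP' : ∀ s : ℝ, 0 < s → HasDerivAt P (β / 2 * φ (Real.sqrt s)) s := by
    intro s hs
    have hc := (hF' (Real.sqrt s)).comp s (Real.hasDerivAt_sqrt hs.ne')
    refine hc.congr_deriv ?_
    have hsq : Real.sqrt s ≠ 0 := (Real.sqrt_pos.2 hs).ne'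
    simp only [hφ]
    field_simp
  -- `deriv P` is antitone on the open interval
  have hconc' : ConcaveOn ℝ (Set.Ioo (a ^ 2) (b ^ 2)) P :=
    hconc.subset Set.Ioo_subset_Icc_self (convex_Ioo _ _)
  have hanti : AntitoneOn (deriv P) (Set.Ioo (a ^ 2) (b ^ 2)) :=
    hconc'.antitoneOn_deriv fun s hs =>
      (hP' s (lt_of_le_of_lt (sq_nonneg a) hs.1)).differentiableAt
  -- hence the chord susceptibility `φ` is antitone on `(a, b)`
  have hφanti : AntitoneOn φ (Set.Ioo a b) := by
    intro x hx y hy hxy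
    have hx0 : 0 < x := lt_of_le_of_lt ha hx.1
    have hy0 : 0 < y := lt_of_le_of_lt ha hy.1
    have hmem : ∀ z ∈ Set.Ioo a b, z ^ 2 ∈ Set.Ioo (a ^ 2) (b ^ 2) := by
      intro z hz
      have hz0 : 0 < z := lt_of_le_of_lt ha hz.1
      exact ⟨by nlinarith [hz.1], by nlinarith [hz.2]⟩
    have h2 := hanti (hmem x hx) (hmem y hy) (by nlinarith)
    rw [(hP' (x ^ 2) (by positivity)).deriv, (hP' (y ^ 2) (by positivity)).deriv,
      Real.sqrt_sq hx0.le, Real.sqrt_sq hy0.le] at h2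
    have hβ2 : 0 < β / 2 := by positivity
    exact le_of_mul_le_mul_left h2 hβ2
  -- and its derivative `(β/h)·[…]` is non-positive
  have hφ' := hasDerivAt_chordSusceptibility hHerm hH hQm hQp hq hβ (lt_of_le_of_lt ha hh.1)
  have hdw : derivWithin φ (Set.Ioo a b) h ≤ 0 := hφanti.derivWithin_nonpos
  rw [derivWithin_of_isOpen isOpen_Ioo hh, hφ'.deriv] at hdw
  have hpos : 0 < β / h := div_pos hβ (lt_of_le_of_lt ha hh.1)
  rw [← mul_zero (β / h)] at hdw
  exact le_of_mul_le_mul_left hdw hpos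

/-- **Concavity in the squared source implies the anomalous sign** `Re(Qm,Qm)_{Duh; H-hΦ₁} ≤ (Re⟨Qm⟩_{H-hΦ₁})²`
along `h ∈ (a,b)` (converse of `concaveOn_sq_source_of_anomalous_nonpos`). [folklore] -/
theorem anomalous_nonpos_of_concaveOn_sq_source (hHerm : H.IsHermitian)
    (hH : diagonal d * H - H * diagonal d = 0) (hQm : diagonal d * Qm - Qm * diagonal d = -q • Qm)
    (hQp : diagonal d * Qmᴴ - Qmᴴ * diagonal d = q • Qmᴴ) (hq : q ≠ 0) [Nonempty n] {β : ℝ} (hβ : 0 < β)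
    {a b : ℝ} (ha : 0 ≤ a)
    (hconc : ConcaveOn ℝ (Set.Icc (a ^ 2) (b ^ 2))
      (fun s : ℝ => Real.log (partitionFn β (H - ((Real.sqrt s : ℝ) : ℂ) • (Qm + Qmᴴ))).re)) :
    ∀ h ∈ Set.Ioo a b,
      (duhamel β (H - (h : ℂ) • (Qm + Qmᴴ)) Qm Qm).re ≤ (gibbsState β (H - (h : ℂ) • (Qm + Qmᴴ)) Qm).re ^ 2 := by
  intro h hh
  have hKherm : (H - (h : ℂ) • (Qm + Qmᴴ)).IsHermitian :=
    isHermitian_sub_smul hHerm (isHermitian_longitudinal Qm) h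
  have e := longitudinal_sub_transverse_eq_four_mul_anomalous hKherm β Qm
  have hs := longitudinal_sub_transverse_nonpos_of_concaveOn_sq_source hHerm hH hQm hQp hq hβ ha hconc h hh
  linarith

end Converse


end Literature.MathematicalPhysics.QuantumLattice
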